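import Mathlib
import Literature.Computability.AlgebraicComplexity.OrbitClosureWeights
import Literature.Computability.AlgebraicComplexity.MultiplicityObstructionsProofs

/-!
# Seed criterion: algebraic independence in an orbit-closure coordinate ring from one
# parametrised family of `End`-orbit points (explicit highest-weight-vector axis of `stub_seedRichness`)

Crux `ValuativeGCT.ValuativeFlip` (stmt-ValiantsHypothesis-12624), line `big-cell-semigroup-floor`,
stub `stub_seedRichness` (rich algebraically independent families of highest-weight vectors of one
weight in `ℂ[Δ_m(X₀₀^{m-n} per_n)]`).  This helper file supplies the three general-purpose engines an
EXPLICIT construction of such families needs: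

* `algebraicIndependent_mk_of_genericOrbitMap` — **the seed criterion**: polynomial functions
  `F_i ∈ k[Sym^m]` have algebraically independent classes in `k[Δ_m(f)] = k[Sym^m] ⧸ I(GL · f)` as soon
  as their values `F_i(P · f)` along ONE matrix `P` with entries in some `k`-algebra `A` (a parametrised
  family of points of the endomorphism orbit `End · f ⊆ Δ(f)`, invertible or not) are algebraically
  independent in `A`.  (`I(GL · f)` is the kernel of the generic orbit map
  `orbitVanishingIdeal_eq_ker_genericOrbitMap`, and the generic matrix specialises to `P`,
  `aeval_genericOrbitMap_matrix`.)
* `algebraicIndependent_pow` — raising an algebraically independent family to positive powers keeps it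
  algebraically independent (used to move seeds of proportional weights to one common weight).
* `algebraicIndependent_of_triangular` — a TRIANGULAR family `g_r = c_r X_r + (polynomial in X_j, j < r)`,
  `c_r ≠ 0`, is algebraically independent (the substitution `X_r ↦ g_r` is a surjective, hence injective,
  endomorphism of the Noetherian ring `K[X_0, …, X_{n-1}]`, `injective_of_surjective_algHom`), and so is
  its image under any algebraically independent family (`algebraicIndependent_aeval_of_triangular`).

No definitions are introduced.  Sources: Mulmuley–Sohoni 2001 §4 (orbit map); folklore commutative
algebra (Vasconcelos' surjective-endomorphism lemma, triangular automorphisms).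
-/

set_option linter.dupNamespace false

namespace Summit.ValiantsHypothesis.ValiantsHypothesis.Theorems.ValuativeFlip

open MvPolynomial Literature.NumberTheory.DiophantineGeometry
open Literature.Computability.AlgebraicComplexity

noncomputable section

/-! ## Specialising the generic orbit map to a matrix with entries in a `k`-algebra -/

/-- **Specialisation of the generic orbit map.** Evaluating the generic matrix `Y` at a matrix `P`
with entries in a commutative `k`-algebra `A` turns `genericOrbitMap f m F = F((Y · f)_m)` into
`F` evaluated at the degree-`m` coefficients of `P · f` (computed over `A`). [folklore] -/
theorem aeval_genericOrbitMap_matrix {σ : Type*} [Fintype σ] [LinearOrder σ] {k : Type*} [Field k]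
    {A : Type*} [CommRing A] [Algebra k A] (f : MvPolynomial σ k) (m : ℕ)
    (F : MvPolynomial (DegIdx σ m) k) (P : Matrix σ σ A) :
    aeval (fun ij : σ × σ => P ij.1 ij.2) (genericOrbitMap f m F) =
      aeval (fun d : DegIdx σ m => coeff d.1 (linSubst σ A P (map (algebraMap k A) f))) F := by
  set φ : MvPolynomial (σ × σ) k →+* A :=
    (aeval (fun ij : σ × σ => P ij.1 ij.2) : MvPolynomial (σ × σ) k →ₐ[k] A).toRingHom with hφ
  have hY : (Matrix.mvPolynomialX σ σ k).map φ = P := by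
    ext i j
    simp [hφ, Matrix.mvPolynomialX_apply]
  have hC : φ.comp (C : k →+* MvPolynomial (σ × σ) k) = algebraMap k A := by
    ext c
    simp [hφ]
  have hfun : (fun d : DegIdx σ m => aeval (fun ij : σ × σ => P ij.1 ij.2)
      (coeff d.1 (linSubst σ (MvPolynomial (σ × σ) k) (Matrix.mvPolynomialX σ σ k)
        (map (C : k →+* MvPolynomial (σ × σ) k) f)))) =
      fun d => coeff d.1 (linSubst σ A P (map (algebraMap k A) f)) := by
    funext d
    change φ (coeff d.1 _) = _
    rw [← coeff_map, map_linSubst, hY, map_map, hC]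
  rw [genericOrbitMap, ← AlgHom.comp_apply, comp_aeval, hfun]

/-! ## The seed criterion -/

/-- **Seed criterion.** Let `f ∈ k[x_σ]` (`k` an infinite field), `F_i ∈ k[Sym^m]` polynomial functions
on forms of degree `m`, and `P` a `σ × σ` matrix with entries in a commutative `k`-algebra `A` (a family
of points `P · f` of the endomorphism orbit of `f`, parametrised by `Spec A`).  If the values
`F_i((P · f)_m) ∈ A` are algebraically independent over `k`, then the classes of the `F_i` in the
coordinate ring `k[Δ_m(f)] = k[Sym^m] ⧸ I(GL · f)` are algebraically independent: a polynomial relation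
among the classes is an element of `I(GL · f) = ker(genericOrbitMap f m)`
(`orbitVanishingIdeal_eq_ker_genericOrbitMap`), and the generic orbit map specialises to `P`
(`aeval_genericOrbitMap_matrix`). [folklore; Mulmuley–Sohoni 2001 §4] -/
theorem algebraicIndependent_mk_of_genericOrbitMap {σ : Type*} [Fintype σ] [LinearOrder σ]
    {k : Type*} [Field k] [Infinite k] {A : Type*} [CommRing A] [Algebra k A]
    (f : MvPolynomial σ k) (m : ℕ) {ι : Type*} (F : ι → MvPolynomial (DegIdx σ m) k)
    (P : Matrix σ σ A)
    (h : AlgebraicIndependent k fun i =>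
      aeval (fun d : DegIdx σ m => coeff d.1 (linSubst σ A P (map (algebraMap k A) f))) (F i)) :
    AlgebraicIndependent k fun i => Ideal.Quotient.mk (orbitVanishingIdeal f m) (F i) := by
  rw [algebraicIndependent_iff] at h ⊢
  intro p hp
  apply h
  -- the relation lifts to an element of the vanishing ideal
  have e1 : aeval (fun i => Ideal.Quotient.mk (orbitVanishingIdeal f m) (F i)) p =
      Ideal.Quotient.mkₐ k (orbitVanishingIdeal f m) (aeval F p) := by
    rw [← AlgHom.comp_apply, comp_aeval]
    rfl
  rw [e1, Ideal.Quotient.mkₐ_eq_mk, Ideal.Quotient.eq_zero_iff_mem,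
    orbitVanishingIdeal_eq_ker_genericOrbitMap, RingHom.mem_ker] at hp
  -- `hp : genericOrbitMap f m (aeval F p) = 0`; specialise the generic matrix to `P`
  have hfun : (fun i => aeval (fun d : DegIdx σ m =>
      coeff d.1 (linSubst σ A P (map (algebraMap k A) f))) (F i)) =
      fun i => (aeval fun ij : σ × σ => P ij.1 ij.2) ((genericOrbitMap f m) (F i)) := by
    funext i
    exact (aeval_genericOrbitMap_matrix f m (F i) P).symm
  have c1 : (aeval fun i => (aeval fun ij : σ × σ => P ij.1 ij.2) ((genericOrbitMap f m) (F i))) =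
      (aeval fun ij : σ × σ => P ij.1 ij.2).comp ((genericOrbitMap f m).comp (aeval F)) := by
    rw [comp_aeval, comp_aeval]
  have e2 : (aeval fun i => aeval (fun d : DegIdx σ m =>
      coeff d.1 (linSubst σ A P (map (algebraMap k A) f))) (F i)) p =
      aeval (fun ij : σ × σ => P ij.1 ij.2) (genericOrbitMap f m (aeval F p)) := by
    rw [hfun, c1]
    rfl
  rw [e2]
  change aeval _ ((genericOrbitMap f m) (aeval F p)) = 0
  rw [genericOrbitMap, hp, map_zero]

/-! ## Powers of an algebraically independent family -/

/-- Raising each member of an algebraically independent family (over a field) to a positive power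
keeps the family algebraically independent (`X ^ e` is transcendental). [folklore] -/
theorem algebraicIndependent_pow {ι K A : Type*} [Field K] [CommRing A] [Algebra K A]
    {x : ι → A} (hx : AlgebraicIndependent K x) (e : ι → ℕ) (he : ∀ i, 0 < e i) :
    AlgebraicIndependent K fun i => x i ^ e i := by
  have h := hx.polynomial_aeval_of_transcendental (f := fun i => (Polynomial.X : Polynomial K) ^ e i)
    (fun i => (Polynomial.transcendental_X K).pow (he i))
  simpa using h

/-! ## Triangular families -/

/-- A surjective `K`-algebra endomorphism of a Noetherian commutative ring is injective (the kernels
of its iterates stabilise; Vasconcelos). [folklore] -/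
theorem injective_of_surjective_algHom {K A : Type*} [CommRing K] [CommRing A] [Algebra K A]
    [IsNoetherianRing A] (φ : A →ₐ[K] A) (hφ : Function.Surjective φ) : Function.Injective φ := by
  -- the ascending chain of kernels of the iterates
  let f : ℕ →o Ideal A :=
    { toFun := fun n => RingHom.ker (φ ^ n).toRingHom
      monotone' := by
        refine monotone_nat_of_le_succ fun n => ?_
        intro x hx
        rw [RingHom.mem_ker] at hx ⊢
        change (φ ^ (n + 1)) x = 0
        change (φ ^ n) x = 0 at hx
        rw [pow_succ', AlgHom.mul_apply, hx, map_zero] }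
  obtain ⟨N, hN⟩ := (monotone_stabilizes_iff_noetherian.mpr (inferInstance : IsNoetherian A A)) f
  have hsurjN : Function.Surjective (φ ^ N) := by
    rw [AlgHom.coe_pow]
    exact hφ.iterate N
  intro x y hxy
  rw [← sub_eq_zero] at hxy ⊢
  rw [← map_sub] at hxy
  obtain ⟨w, hw'⟩ := hsurjN (x - y)
  have hw : w ∈ f (N + 1) := by
    change w ∈ RingHom.ker (φ ^ (N + 1)).toRingHom
    rw [RingHom.mem_ker]
    change (φ ^ (N + 1)) w = 0
    rw [pow_succ', AlgHom.mul_apply, hw', hxy]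
  rw [← hN (N + 1) (Nat.le_succ N)] at hw
  change w ∈ RingHom.ker (φ ^ N).toRingHom at hw
  rw [RingHom.mem_ker] at hw
  rw [← hw']
  exact hw

/-- **Triangular families are algebraically independent.** If `g_r - c_r X_r` (`c_r ≠ 0`) only involves
the variables `X_j`, `j < r`, then `g_0, …, g_{n-1} ∈ K[X_0, …, X_{n-1}]` are algebraically independent:
the substitution `X_r ↦ g_r` is surjective (each `X_r` is recovered by induction on `r`), hence
injective (`injective_of_surjective_algHom`). [folklore] -/
theorem algebraicIndependent_of_triangular {K : Type*} [Field K] {n : ℕ}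
    (g : Fin n → MvPolynomial (Fin n) K)
    (hg : ∀ r : Fin n, ∃ c : K, c ≠ 0 ∧ g r - C c * X r ∈ supported K {j : Fin n | j < r}) :
    AlgebraicIndependent K g := by
  rw [algebraicIndependent_iff_injective_aeval]
  set φ : MvPolynomial (Fin n) K →ₐ[K] MvPolynomial (Fin n) K := aeval g with hφ
  apply injective_of_surjective_algHom φ
  -- surjectivity: every variable lies in the range, by strong induction on its index
  have hX : ∀ (N : ℕ) (r : Fin n), (r : ℕ) < N → (X r : MvPolynomial (Fin n) K) ∈ φ.range := by
    intro N
    induction N with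
    | zero => intro r hr; exact absurd hr (Nat.not_lt_zero _)
    | succ N ih =>
      intro r hr
      obtain ⟨c, hc, hsupp⟩ := hg r
      have hlow : g r - C c * X r ∈ φ.range := by
        have hle : supported K {j : Fin n | j < r} ≤ φ.range := by
          rw [supported_eq_adjoin_X, Algebra.adjoin_le_iff, Set.image_subset_iff]
          intro j hj
          have hj' : (j : ℕ) < r := Fin.lt_def.mp hj
          exact ih j (by omega)
        exact hle hsupp
      have hgr : g r ∈ φ.range := ⟨X r, by rw [hφ]; exact aeval_X g r⟩
      have hCX : C c * X r ∈ φ.range := by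
        have := φ.range.sub_mem hgr hlow
        rwa [sub_sub_cancel] at this
      have hCc : (C c⁻¹ : MvPolynomial (Fin n) K) ∈ φ.range := by
        simpa only [MvPolynomial.algebraMap_eq] using φ.range.algebraMap_mem c⁻¹
      have hXr : (X r : MvPolynomial (Fin n) K) = C c⁻¹ * (C c * X r) := by
        rw [← mul_assoc, ← C_mul, inv_mul_cancel₀ hc, C_1, one_mul]
      rw [hXr]
      exact φ.range.mul_mem hCc hCX
  have htop : φ.range = ⊤ := by
    rw [eq_top_iff, ← MvPolynomial.adjoin_range_X, Algebra.adjoin_le_iff]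
    rintro _ ⟨r, rfl⟩
    exact hX ((r : ℕ) + 1) r (Nat.lt_succ_self _)
  intro p
  have hp : p ∈ φ.range := htop ▸ Algebra.mem_top
  exact (AlgHom.mem_range φ).mp hp

/-- The image of a triangular family under an algebraically independent family `e` is algebraically
independent: `r ↦ g_r(e_0, …, e_{n-1})`. [folklore] -/
theorem algebraicIndependent_aeval_of_triangular {K A : Type*} [Field K] [CommRing A] [Algebra K A]
    {n : ℕ} {e : Fin n → A} (he : AlgebraicIndependent K e) (g : Fin n → MvPolynomial (Fin n) K)
    (hg : ∀ r : Fin n, ∃ c : K, c ≠ 0 ∧ g r - C c * X r ∈ supported K {j : Fin n | j < r}) :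
    AlgebraicIndependent K fun r => aeval e (g r) :=
  he.aeval_of_algebraicIndependent (algebraicIndependent_of_triangular g hg)

end

end Summit.ValiantsHypothesis.ValiantsHypothesis.Theorems.ValuativeFlip
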